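import Mathlib
import Summits.Ventures.PercRepro2.Defs
import Summits.Ventures.PercRepro2.Harris
import Summits.Ventures.PercRepro2.Graph
import Summits.Ventures.PercRepro2.Events
import Summits.Ventures.PercRepro2.R21PinInduction

/-!
# The (R2-1) pin induction with the WEAKEST one-edge hypothesis `T_f ≥ 0` (PercRepro2, p2)

The frame `r21_slack_nonneg_of_uni_o` (R21PinInduction.lean) asks, at some unpinned edge `f` of the
explored `o`-component, for the MIN-form `2·min(R⁰, R¹) ≤ T_f`.  That one-edge property — (UNI-R_o)
at unmarked far ends, the hypothesis `hG` of `r21_pair_of_generic` — is FALSE: exact witnesses (P2-G20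
record, kit j301815: 8 / 15,699,008 edges at n = 7–8, e.g. `n = 8`, `(s,y,o,u) = (0,2,7,6)`, the edge
`{o, 4}` of weight `1/10`: `R⁰ = 1.15877·10⁻⁵`, `R¹ = 1.11477·10⁻⁵`, `T = 2.19067·10⁻⁵ < 2·min`).
But the pin induction never needed the min-form: with `R(p) = (1 − w)²R⁰ + w(1 − w)T + w²R¹` and the
induction hypotheses `R⁰, R¹ ≥ 0`, the step only needs **`T_f ≥ 0`** (`r21_step_algebra_T`), which
holds at EVERY edge of every instance in every census (0 failures on 15,699,008 + 86,564 edges).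
So the frame of record becomes **(R2-1) ⟸ (UNI-T_o)**: `r21_slack_nonneg_of_T_o` — if every admissible
`p` with an unpinned edge at its explored `o`-component has SOME such edge `f` with
`0 ≤ R(p[f↦0]) → 0 ≤ R(p[f↦1]) → 0 ≤ T_f(p)`, then `0 ≤ R(p)` for every admissible `p` (base:
`r21_slack_eq_zero_of_explored_o`).

* `r21_step_algebra_T` — the one-edge step from `T ≥ 0`;
* `r21_slack_nonneg_of_T_o` — **the frame (R2-1) ⟸ (UNI-T_o)**.
-/

namespace Summit.Ventures.PercRepro2

section R21TFrame

variable {V : Type*} {E : Type*} [Fintype E] [DecidableEq E]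
  {R : Type*} [CommRing R] [LinearOrder R] [IsStrictOrderedRing R]

/-- **The one-edge step from `T ≥ 0`.** If `0 ≤ w ≤ 1`, the two endpoint slacks are nonnegative and
the mixed term `T` is nonnegative, then `(1 − w)²R⁰ + w(1 − w)T + w²R¹ ≥ 0`. -/
lemma r21_step_algebra_T {w R0 R1 T : R} (hw : 0 ≤ w) (hw1 : w ≤ 1) (h0 : 0 ≤ R0) (h1 : 0 ≤ R1)
    (hT : 0 ≤ T) : 0 ≤ (1 - w) ^ 2 * R0 + w * (1 - w) * T + w ^ 2 * R1 := by
  have hw' : 0 ≤ 1 - w := by linarith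
  have e1 : 0 ≤ (1 - w) ^ 2 * R0 := mul_nonneg (by positivity) h0
  have e2 : 0 ≤ w * (1 - w) * T := mul_nonneg (mul_nonneg hw hw') hT
  have e3 : 0 ≤ w ^ 2 * R1 := mul_nonneg (by positivity) h1
  linarith

/-- **The frame (R2-1) ⟸ (UNI-T_o).** If every admissible `p` with an unpinned edge at its explored
`o`-component has SOME such edge `f` whose symmetric mixed Bernstein term `T_f(p)` is nonnegative
(given the two pinned slacks are), then `0 ≤ R(p)` for every admissible `p`. -/
theorem r21_slack_nonneg_of_T_o (ends : E → Sym2 V) (s y o u : V)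
    (hT : ∀ p : E → R, IsProbVec p →
      (∃ e, (∃ v ∈ ends e, Conn ends (fun e => decide (p e = 1)) o v) ∧ p e ≠ 0 ∧ p e ≠ 1) →
      ∃ f, (∃ v ∈ ends f, Conn ends (fun e => decide (p e = 1)) o v) ∧ p f ≠ 0 ∧ p f ≠ 1 ∧
        (0 ≤ (prob (Function.update p f 0) (connEvent ends s u ∩ clusterInEvent ends s {W : Set V | o ∈ W} ∩ (connEvent ends s y)ᶜ) + prob (Function.update p f 0) (connEvent ends s u ∩ connEvent ends y o ∩ (connEvent ends s y)ᶜ) + prob (Function.update p f 0) ((connEvent ends s y)ᶜ) * prob (Function.update p f 0) (connEvent ends s u ∩ clusterInEvent ends s {W : Set V | o ∈ W}) - (prob (Function.update p f 0) (connEvent ends s u ∩ (connEvent ends s y)ᶜ) * prob (Function.update p f 0) (clusterInEvent ends s {W : Set V | o ∈ W}) + prob (Function.update p f 0) (clusterInEvent ends s {W : Set V | o ∈ W} ∩ (connEvent ends s y)ᶜ) * prob (Function.update p f 0) (connEvent ends s u) + prob (Function.update p f 0) (connEvent ends y o ∩ (connEvent ends s y)ᶜ) * prob (Function.update p f 0)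 (connEvent ends s u))) → 0 ≤ (prob (Function.update p f 1) (connEvent ends s u ∩ clusterInEvent ends s {W : Set V | o ∈ W} ∩ (connEvent ends s y)ᶜ) + prob (Function.update p f 1) (connEvent ends s u ∩ connEvent ends y o ∩ (connEvent ends s y)ᶜ) + prob (Function.update p f 1) ((connEvent ends s y)ᶜ) * prob (Function.update p f 1) (connEvent ends s u ∩ clusterInEvent ends s {W : Set V | o ∈ W}) - (prob (Function.update p f 1) (connEvent ends s u ∩ (connEvent ends s y)ᶜ) * prob (Function.update p f 1) (clusterInEvent ends s {W : Set V | o ∈ W}) + prob (Function.update p f 1) (clusterInEvent ends s {W : Set V | o ∈ W} ∩ (connEvent ends s y)ᶜ) * prob (Function.update p f 1) (connEvent ends s u) + prob (Function.update p f 1) (connEvent ends y o ∩ (connEvent ends s y)ᶜ) * prob (Function.update p f 1) (connEvent ends s u))) → 0 ≤ (prob (Function.update p f 0) (connEvent ends s u ∩ clusterInEvent ends s {W : Set V | o ∈ W} ∩ (connEvent ends s y)ᶜ) + prob (Function.update p f 1) (connEvent ends s u ∩ clusterInEvent ends s {W : Set V | o ∈ W} ∩ (connEvent ends s y)ᶜ)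 + prob (Function.update p f 0) (connEvent ends s u ∩ connEvent ends y o ∩ (connEvent ends s y)ᶜ) + prob (Function.update p f 1) (connEvent ends s u ∩ connEvent ends y o ∩ (connEvent ends s y)ᶜ) + prob (Function.update p f 0) ((connEvent ends s y)ᶜ) * prob (Function.update p f 1) (connEvent ends s u ∩ clusterInEvent ends s {W : Set V | o ∈ W}) + prob (Function.update p f 1) ((connEvent ends s y)ᶜ) * prob (Function.update p f 0) (connEvent ends s u ∩ clusterInEvent ends s {W : Set V | o ∈ W}) - (prob (Function.update p f 0) (connEvent ends s u ∩ (connEvent ends s y)ᶜ) * prob (Function.update p f 1) (clusterInEvent ends s {W : Set V | o ∈ W}) + prob (Function.update p f 1) (connEvent ends s u ∩ (connEvent ends s y)ᶜ) * prob (Function.update p f 0) (clusterInEvent ends s {W : Set V | o ∈ W}) + prob (Function.update p f 0) (clusterInEvent ends s {W : Set V | o ∈ W} ∩ (connEvent ends s y)ᶜ) * prob (Function.update p f 1) (connEvent ends s u) + prob (Function.update p f 1) (clusterInEvent ends s {W : Set V | o ∈ W} ∩ (connEvent ends s y)ᶜ) * prob (Function.update p f 0) (connEvent ends s u) + prob (Function.update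 p f 0) (connEvent ends y o ∩ (connEvent ends s y)ᶜ) * prob (Function.update p f 1) (connEvent ends s u) + prob (Function.update p f 1) (connEvent ends y o ∩ (connEvent ends s y)ᶜ) * prob (Function.update p f 0) (connEvent ends s u))))) :
    ∀ p : E → R, IsProbVec p → 0 ≤ (prob p (connEvent ends s u ∩ clusterInEvent ends s {W : Set V | o ∈ W} ∩ (connEvent ends s y)ᶜ) + prob p (connEvent ends s u ∩ connEvent ends y o ∩ (connEvent ends s y)ᶜ) + prob p ((connEvent ends s y)ᶜ) * prob p (connEvent ends s u ∩ clusterInEvent ends s {W : Set V | o ∈ W}) - (prob p (connEvent ends s u ∩ (connEvent ends s y)ᶜ) * prob p (clusterInEvent ends s {W : Set V | o ∈ W}) + prob p (clusterInEvent ends s {W : Set V | o ∈ W} ∩ (connEvent ends s y)ᶜ) * prob p (connEvent ends s u) + prob p (connEvent ends y o ∩ (connEvent ends s y)ᶜ) * prob p (connEvent ends s u))) := by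
  refine r21_slack_nonneg_of_step ends s y o u fun p hp hex => ?_
  by_cases hex' : ∃ e, (∃ v ∈ ends e, Conn ends (fun e => decide (p e = 1)) o v) ∧ p e ≠ 0 ∧ p e ≠ 1
  · obtain ⟨f, _, hf0, hf1, hTf⟩ := hT p hp hex'
    refine ⟨f, hf0, hf1, fun h0 h1 => ?_⟩
    rw [r21_slack_eq_bernstein p ends s y o u f]
    exact r21_step_algebra_T (hp.nonneg f) (hp.le_one f) h0 h1 (hTf h0 h1)
  · obtain ⟨e, he0, he1⟩ := hex
    have hpin : ∀ e, (∃ v ∈ ends e, Conn ends (fun e => decide (p e = 1)) o v) →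
        p e = 0 ∨ p e = 1 := by
      intro e hv
      by_contra hne
      exact hex' ⟨e, hv, fun h => hne (Or.inl h), fun h => hne (Or.inr h)⟩
    exact ⟨e, he0, he1, fun _ _ => by
      rw [r21_slack_eq_zero_of_explored_o p hp ends s y o u hpin]⟩


end R21TFrame

end Summit.Ventures.PercRepro2
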